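import Summits.BirchSwinnertonDyer.Rank1Residual.O5.O5LayerLaws
import HarnessLib

/-!
# O5 at `p = 3`: the GROWTH LAWS of the Mazur–Tate layer elements — the `χ₋₃`-twist transport (T8),
# the growth DICHOTOMY by `v₃(j − 1728)` (T9) and the CONGRUENCE TRANSPORT law (T11); T10 refuted
# (cell `b2b-bsdres`, lane CLASS-CLOSURE, team o5, planner o5-r1 GEN 2 — E1 statement discovery with
#  held-out validation; content = o5-r1, placement + dedup = class typer; add-on to `O5LayerLaws.lean`
#  (p252658) — TYPED, EVIDENCE-LABELLED, NOTHING ASSERTED)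

HONEST FRAMING (cell `b2b-bsdres`, verbatim in every file): the goal of the cell is to DELETE the
COMBINATION-SHAPED residual classes of the Birch–Swinnerton-Dyer formula for ALL analytic-rank `≤ 1`
elliptic curves over `ℚ` — "full BSD formula for every rank `≤ 1` curve in class `C`" assembled
STRICTLY from published theorems — so that the rank-`≤ 1` remainder becomes exactly the
CONSTRUCTION-SHAPED classes, which are TYPED (missing-input `Prop`s), NOT attempted. This is not
"finishing BSD". Lane CLASS-CLOSURE: census output is EVIDENCE / conjecture items with held-out
validation, never a Literature fact; no main conjecture inside any certificate; nothing is booked.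

Setting and vocabulary as in `O5LayerLaws.lean` (T1 `OmegaDvdMazurTateThree`: `θ_n = ω_{n−1}·u_n`,
`λ(θ_n) = 3^{n−1} + λ(u_n)`; T5 parity; `IsScaledMazurTateLift`; classes `ClassO5`/`SubTprime` of
`Additive/PotSupersingularClasses.lean`; `lam`/`mu` of `X1/MuLambdaAlgebra.lean`).  What is added here:

* **T8 (`TwistTransportLawThree`, THEOREM-CANDIDATE)** — Birch's twisting lemma for `χ₋₃` relates the
  two branches of a curve and of its `χ₋₃`-twist (Kodaira III ↔ III*):
  `λ(θ^±_n(W ⊗ χ₋₃)) ≡ λ(θ^∓_n(W)) + 3^{n−1} (mod 2·3^{n−1})`; exact on the three twist pairs of the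
  pilot at every layer.  Consequence: every O5b law need only be stated for type III (both branches).
* **T9 (`GrowthDichotomyLawThree`, CONJECTURE, E1)** — on O5b with `ρ̄₃` irreducible the growth of
  `λ(u_n)` follows ONE of two templates, selected by the census invariant `s(W) = [v₃(j(W) − 1728) ≥ 7]`
  ("CM-near": `3`-adically close to the `ℤ[i]`-CM point beyond the order `3` forced by `e = 4`; the
  census of all 46 067 O5 rows finds `v₃(j − 1728) ∈ {3} ∪ [7, 21]` on O5b-X4, never `4, 5, 6`):
  GENERIC `s = 0`: `λ(u_n) = [III*]·3^{n−1} + c` eventually constant (unsigned, bounded);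
  CM-NEAR `s = 1`: `λ(u_n) = [III*]·3^{n−1} + q_{n−1} + c_{n mod 2}` (signed Kurihara–Pollack growth,
  `q = 0,0,2,6,20,60,…`), exactly as O5a (Lei–Pollack–Pratap Thm 4.5, in print) and as CM `j ∈ {0,1728}`
  at `p ≥ 5` (LLP §4.3).  194/194 row-branches of the pilot fit their template, 1/194 the swapped one.
  This answers, conjecturally, the question Doyon–Lei 2021 §6 leave open ("how these two distinct
  cases arise" among potentially supersingular curves).
* **T10 (generic type-III rigidity `λ(θ_n) = 3^{n−1} + 1`, r0, no jump) — WITHDRAWN: REFUTED BY THE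
  PRE-REGISTERED HELD-OUT RUN H2** (kit j124089, 283 unseen rows, frozen scorer; prereg
  `HOME/b2b-bsdres-o5-r1/gen2/HELDOUT-PREREG.md`): 5 of the 14 qualifying held-out rows have
  `λ(u_n⁺) ∈ {3, 5}` for `n ≥ 2` (cleanest counterexamples 15426d1, 16884e1: `λ(u₁⁺) = 1`, `λ(u_n⁺) = 3`
  for `2 ≤ n ≤ 5`, `μ = 0`, no vanishing layer, `L(W,1)/Ω = 2`).  The pilot's 13/13 was a small-sample
  artefact; the residual constant of T9 is NOT determined by (`r_an`, jumps, `ord₃ L(W,1)/Ω`, torsion,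
  Tamagawa numbers).  What DOES govern it is T11.  (Negative knowledge; tree rule 'deprecate, don't mutate': the decl of p253649 is kept as a WITHDRAWN tombstone without its `@[conjecture]` tag, its corollary `@[deprecated]`.)
* **T11 (`CongruenceTransportLawThree`, THEOREM-CANDIDATE / E3 transport law; found POST-HOC on the
  pilot + H2 data, 100/100, to be pre-registered on fresh conductors as instrument C-A2c)** — the
  additive-at-`3` analogue of Greenberg–Vatsal (2000) / Emerton–Pollack–Weston (2006) / Pollack–Weston
  (2011): for O5b curves `W, W′` with `W[3] ≅ W′[3]` irreducible (tested as `a_ℓ(W) ≡ a_ℓ(W′) (mod 3)`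
  for all good `ℓ ≤ 400`) and the SAME Kodaira type at `3`, for each branch `ε ∈ {+, −}` and `n ≫ 0`:
  `λ(θ^ε_n(W)) − λ(θ^ε_n(W′)) = Σ_{ℓ ∣ N N′, ℓ ≠ 3} [λ(P^ε_{ℓ,n}(W′)) − λ(P^ε_{ℓ,n}(W))]`, where
  `P^ε_{ℓ,n}(W) = 1 − χ_ε(ℓ) a_ℓ ℓ^{−1} σ_ℓ + 1_{ℓ ∤ N} ℓ^{−1} σ_ℓ² ∈ ℚ[Γ_n]` is the layer-`n` Euler factor
  (`χ₊ = 1`, `χ₋ = χ₋₃`; `σ_ℓ ↦ (1+X)^{s}`, `ℓ = ±4^{s} mod 3^{n+1}`) and `λ` of an element of `ℚ[Γ_n]` is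
  the `λ`-invariant of its representative of degree `< 3^n` (`polyLamThree`).  Equivalently the
  `Σ`-imprimitive `λ`, `λ(θ^ε_n(W)) + Σ_{ℓ ∈ Σ} λ(P^ε_{ℓ,n}(W))`, is a CLASS FUNCTION of
  (`W[3]`, Kodaira type at 3, `ε`, `n`).  EVIDENCE: all 50 mod-3-congruent same-type pairs among the 277
  X4 rows with layer data (pilot + H2; pairs across ranks 0/1, across generic/CM-near conductors
  2 070–25 938) satisfy it EXACTLY at the top clean layer on BOTH branches (50/50 `+`, 50/50 `−`;
  `HOME/…/census/mt3_heldout/gv_pairs2.py`); pairs with different local type at 3 fail (31/37), as they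
  must.  Nearest print: Doyon–Lei 2021 Thm 2 (`λ(θ_{n,Δ}) = λ(θ_{n,E})`, `E` of conductor 27, one
  congruence, no Euler correction) and Pollack–Weston 2011 (good non-ordinary `p`); the O5 statement with
  Euler corrections is, as far as searched, not in print.  It EXPLAINS the T10 failure (the residual
  constant is congruence-class data plus Euler-factor `λ`'s) and makes every O5b `λ`-law transportable
  along mod-3 congruences (E3).  VALIDATED on a fresh universe (pre-registered C-A2c: 2 280/2 280 pairs, both branches,
  every clean layer; see the T11 docstring); the `+`-branch law on the whole additive locus was found independently by o6-r1
  (G3-15) and typed as `Additive.MazurTateLambdaCongruenceThree` (p256591) — ONE law, two formulations.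

PLACEMENT NOTE (cc-typer-5 GEN 3, O5/O6 typer of record; re-land of p253649): content VERBATIM from
`HOME/b2b-bsdres-o5-r1/gen2/O5GrowthLaws.lean` v2 (sha16 a815bd05a991eea2; o5-r1 08:50Z A-O5-8
AMENDED), except the Pollack–Weston cite key (`PollackWeston2011MT` = Duke 156; `PollackWeston2011`
is the Compositio anticyclotomic-μ paper) and this note. T8, T9, `kuriharaQ`, `mazurTateElementOddThree`,
`IsScaledOddMazurTateLift` are byte-identical to p253649; the REFUTED T10 (`GenericTypeThreeRigidityLaw`
+ `lam_layerOne_eq_two_of_rigidity`, referenced nowhere else) is KEPT VERBATIM as a WITHDRAWN tombstone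
(`@[conjecture]` dropped, corollary `@[deprecated]`; tree rule deprecate-don't-mutate) — a refuted
statement is not an obligation node (lane rule); T11 is added. DEDUP RULING (typer of record, o5-r1 08:50Z "your call"): ONE
LAW — `λ`-transport along mod-3 congruences at the additive prime `3` (Greenberg–Vatsal / Emerton–
Pollack–Weston / Pollack–Weston shape) — in TWO typed formulations, cross-referenced, neither a
certificate input: (A) `O5.CongruenceTransportLawThree` (T11, below) is the formulation OF RECORD on O5b:
both branches `ε = ±`, eventual in `n`, local terms = `λ` of the explicit layer-`n` Euler elements
(`eulerElementThree`, `polyLamThree` — binder-free and correct also at primes split at layer `n`, where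
the honest `λ`-term is `0`); (B) `Additive.MazurTateLambdaCongruenceThree branch` (o6-r1 (G3-15),
p256591) is the formulation of record OFF O5b (the whole additive locus, in particular the O6 wild rows):
`+` branch, every layer `k`, closed-form terms `m_ℓ·3^{min(k, v₃(ℓ²−1)−1)}` under `μ = 0` / unsaturation /
`m_ℓ ≤ 1` binders (the closed form over-counts at primes with `v₃(ℓ²−1) − 1 ≥ k`; immaterial under those
binders except in a doubly-degenerate configuration met in no pair so far — o5-r1 08:50Z, instrument
C-A2d). On O5b `+`-rows the two agree at every pair-layer met (C-A2c 12 221/12 221; (G3-15) 2 737/2 741).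
A kernel bridge (A) ⟹ (B)|_{O5b, +} needs two prover lemmas, named here as items: L-O56-λpoly
(`polyLamThree (mazurTateElement f 3 n) = lam Θ` for an integral model `Θ`) and L-O56-euler
(`polyLamThree (eulerElementThree W true ℓ n) = epwLayerTermThree W ℓ n` when `v₃(ℓ²−1) − 1 < n`).
`kuriharaQ n` is Kurihara's/Pollack's `q_n` (degree of the tree's `cyclotomicOmegaMinus/Plus 3 (n−1)`),
kept as a closed form so that `kuriharaQ_values` is `decide`; T1 is typed for the WHOLE additive locus as
`Additive.OmegaDvdMazurTateOfAddv`, of which `O5.OmegaDvdMazurTateThree` is the restriction, and its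
valuation consequence (LEMMA A) is the kernel theorem `Additive.mazurTate_norm_ratTwistedSymbolSum_pow_totient_eq_of_addv`
(`Iwasawa/LambdaInvariantValuationOmega.lean`).

EVIDENCE of record: `HOME/b2b-bsdres-o5-r1/gen2/LAYER-LAWS.md` §4–§7 (kit j121825, j122348, j122713,
j122314, j122617, held-out H2 j124089; drivers/outputs `HOME/b2b-bsdres-o5-r1/census/mt3_pilot/`, census invariant table
`census/o5_jmod_rows.tsv`); team file `HOME/cells/o5o6/TARGETS.md` §O5 '#### o5-r1 GEN 2'.
References: [MazurTate1987] Duke 54; [MazurTateTeitelbaum1986Invent] §I.8 (twisting); [Pollack2003]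
Def. 6.15; [Kurihara2002] (`q_n`); [GreenbergVatsal2000] R. Greenberg, V. Vatsal, Invent. Math. 142 (2000);
[PollackWeston2011MT] R. Pollack, T. Weston, Duke Math. J. 156 (2011); [DoyonLei2021] L. Doyon, A. Lei, Ramanujan J. (2021), arXiv:2103.06154,
Thm 2, Lemma 5.2 / Cor. 5.3 / §6 [corpus: paper-arxiv-2103.06154 p0003, p0009–p0010]; [LeiPollackPratap2024]
arXiv:2412.16629 Thm 4.2 (Pal's period relation), Thm 4.5, §4.3, Conj. 4.11 [corpus: paper-arxiv-2412.16629
p0012–p0016].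
-/

set_option autoImplicit false

noncomputable section

open scoped Classical MatrixGroups ModularForm NumberField

open CongruenceSubgroup Polynomial WeierstrassCurve NumberField Literature.NumberTheory.EllipticCurves
  Literature.NumberTheory.EllipticCurves.ModularForms
  Summit.BirchSwinnertonDyer.Rank1Residual.Additive
  Summit.BirchSwinnertonDyer.Rank1Residual.X1.MuLambda

namespace Summit.BirchSwinnertonDyer.Rank1Residual.O5

/-! ## §1 T8 — the `χ₋₃`-TWIST TRANSPORT law (theorem-candidate; transports every law III ↔ III*) -/

/-- The **odd-branch Mazur–Tate element** `θ⁻_n(f) = θ_{n,1}(f) ∈ ℚ[T]` at `p = 3` (tame character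
`ω = χ₋₃`, `ω(η) = η` on `μ₂ ⊂ ℤ₃^×`): the tree's `mazurTateElement f 3 n` with the plus symbol
`[r]⁺_f` replaced by `ω(η)·[r]⁻_f` (`ratMinusSymbol`, period `Ω⁻_f`).  Same level `3^{n+1}`, same
variable `γ ↦ 1 + T`. [cite: MazurTate1987, §1] [cite: Pollack2003, Def. 6.15] -/
def mazurTateElementOddThree {N : ℕ} (f : CuspForm (Gamma0 N) 2) (n : ℕ) : ℚ[X] :=
  ∑ᶠ ε : rootsOfUnity (torsionOrder 3) ℤ_[3], ∑ s : ZMod (3 ^ n),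
    C ((if ((ε : ℤ_[3]ˣ) : ℤ_[3]) = 1 then (1 : ℚ) else -1) * ratMinusSymbol f
        (((PadicInt.toZModPow (n + cyclotomicExponent 3) ((ε : ℤ_[3]ˣ) : ℤ_[3]) *
              (cyclotomicGenerator 3 : ZMod (3 ^ (n + cyclotomicExponent 3))) ^ s.val).val : ℚ) /
          (3 : ℚ) ^ (n + cyclotomicExponent 3))) *
      (X + 1) ^ s.val

/-- `Θ ∈ Λ` is an integral lift of `3^k · θ⁻_n(f)` (odd branch; twin of `IsScaledMazurTateLift`). [folklore] -/
def IsScaledOddMazurTateLift {N : ℕ} (f : CuspForm (Gamma0 N) 2) (n k : ℕ) (Θ : IwasawaAlgebra 3) :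
    Prop :=
  iwasawaToPowerSeries 3 Θ =
    PowerSeries.C ((3 : ℚ_[3]) ^ k) * ((mazurTateElementOddThree f n).map (algebraMap ℚ ℚ_[3]))

/-- **T8 TWIST TRANSPORT LAW (THEOREM-CANDIDATE; EVIDENCE-labelled).**  Let `W ∈ O5b` at `3` and let
`W'` be its quadratic twist by `χ₋₃` (typed through the `L`-coefficients: `a_m(W') = (−3/m)·a_m(W)`;
`W' ∈ O5b` again, Kodaira III ↔ III*).  Birch's lemma `f ⊗ χ = τ(χ̄)^{-1} Σ_u χ̄(u) f(z + u/3)` gives,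
in `ℚ[Γ_n]`, `θ^±_n(W') = τ(χ₋₃)^{-1} · (σ_g^{-1} − σ_g) · θ^∓_n(W)` with `g = 1 + 3^n`
(`σ_g^{-1} − σ_g ≐ ω_{n−1} ·` unit); with T1 (`θ = ω_{n−1} u`, `deg u < 2·3^{n−1} = [ℚ₃(ζ_{3^n}):ℚ₃]`)
and the exact Weierstrass count `ord₃ u(ζ_{3^n} − 1) = μ(u) + λ(u)/(2·3^{n−1})`, the valuation shift
`ord₃ τ(χ₋₃)^{-1}(ζ₃² − 1) = 0` plus the period ratio `ord₃(Ω^∓_W √−3 / Ω^±_{W'}) ∈ ℤ` yield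
`λ(θ^±_n(W')) ≡ λ(θ^∓_n(W)) + 3^{n−1} (mod 2·3^{n−1})` — typed here for the tree's even branch of
`W'` against the odd branch of `W`.  It transports every growth law between Kodaira types III and
III* (`λ(u⁺_n(III*)) = λ(u⁻_n(III)) ± 3^{n−1}`).  The only non-formal input is the integrality of the
period ratio (Pal's theorem, LLP Thm 4.2, covers `E^F` semistable; here both curves are additive —
engine ask E-O5-4).  EVIDENCE: exact on the three `χ₋₃`-twist pairs inside the pilot, every layer
`n ≤ 5/6`, both directions (990b1/990h1, 9900e1/9900h1, 17568a1/17568g1; kit j121825/j122348), and on the six further pairs of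
the held-out run H2 (kit j124089: 58/58 layer checks + 2 both-zero layers).
[cite: LeiPollackPratap2024, Thm 4.2 and proof of Thm 4.3] [cite: MazurTateTeitelbaum1986Invent, §I.8] -/
@[conjecture] def TwistTransportLawThree : Prop :=
  ∀ (W W' : WeierstrassCurve ℚ) [W.IsElliptic] [W.IsGloballyMinimal] [NeZero (W.conductorNorm ℤ)]
    [W'.IsElliptic] [W'.IsGloballyMinimal] [NeZero (W'.conductorNorm ℤ)]
    (f : CuspForm (Gamma0 (W.conductorNorm ℤ)) 2) (f' : CuspForm (Gamma0 (W'.conductorNorm ℤ)) 2),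
    IsNewformOf W f → IsNewformOf W' f' → ClassO5 W 3 → SubTprime W 3 →
    (∀ m : ℕ, W'.LFunction m = jacobiSym (-3) m * W.LFunction m) →
    ∀ (n k k' : ℕ) (Θ Θ' : IwasawaAlgebra 3), 1 ≤ n →
      IsScaledOddMazurTateLift f n k Θ → IsScaledMazurTateLift f' n k' Θ' → Θ ≠ 0 → Θ' ≠ 0 →
      lam Θ' % (2 * 3 ^ (n - 1)) = (lam Θ + 3 ^ (n - 1)) % (2 * 3 ^ (n - 1))

/-! ## §2 T9/T10 — the GROWTH DICHOTOMY by `v₃(j − 1728)` and the generic type-III rigidity (conjectures) -/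

/-- Kurihara's **`q_n`** at `p = 3`: `q_n = 3^{n−1} − 3^{n−2} + ⋯ ± …` (`q_0 = q_1 = 0`, `q_2 = 2`,
`q_3 = 6`, `q_4 = 20`, `q_5 = 60`, `q_6 = 182`; `q_n + q_{n+1} = 3^n − 1`), in the closed form
`(3^n − 1)/4` (`n` even), `(3^n − 3)/4` (`n` odd). [cite: Kurihara2002, §0] [cite: Pollack2003, §6] -/
def kuriharaQ (n : ℕ) : ℕ := (3 ^ n - if n % 2 = 0 then 1 else 3) / 4

/-- sanity: the first values of `q_n`. [folklore] -/
theorem kuriharaQ_values :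
    kuriharaQ 0 = 0 ∧ kuriharaQ 1 = 0 ∧ kuriharaQ 2 = 2 ∧ kuriharaQ 3 = 6 ∧ kuriharaQ 4 = 20 ∧
      kuriharaQ 5 = 60 ∧ kuriharaQ 6 = 182 := by
  decide

/-- **T9 GROWTH DICHOTOMY LAW on O5b at `3` (CONJECTURE; EVIDENCE-labelled; E1 statement discovery
with held-out validation; answers the question left open by Doyon–Lei 2021 §6, "how these two distinct
cases arise").**  For a non-CM `W ∈ O5b` (`e = 4`, Kodaira III or III*) with `ρ̄_{W,3}` irreducible,
the even-branch λ-invariants grow, for `n ≥ n₀(W)`, as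
`λ(θ_n(W)) = b(W)·3^{n−1} + s(W)·q_{n−1} + c_{n mod 2}(W)`, where `b = 1` for type III
(`v₃(Δ_min) = 3`) and `b = 2` for type III* (`v₃(Δ_min) = 9`) — the `χ₋₃`-twist shift of T8 —,
`s(W) = 1` iff `v₃(j(W) − 1728) ≥ 7` ("CM-NEAR": `3`-adically close to the `ℤ[i]`-CM point, beyond the
forced `v₃(j − 1728) = 3 = v₃(1728)`; on the 31 044 O5b-X4 rows of the census `v₃(j − 1728) ∈ {3} ∪
[7, 21]`, never `4, 5, 6`: 19 734 GENERIC / 11 310 CM-NEAR), `s(W) = 0` otherwise, and the residual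
constants satisfy `c₀ = c₁` in the generic case (`v₃(j)`, i.e. proximity to `j = 0`, is irrelevant:
rows with `v₃(j) = 9, 12` are generic).  So GENERIC curves have an UNSIGNED bounded pattern
(`λ(u_n)` eventually constant — a bounded "`3`-adic `L`-function-like" class in `Λ`) and CM-NEAR curves
the SIGNED Kurihara–Pollack pattern (`q_{n−1}` + a `2`-periodic constant, as for `j ∈ {0, 1728}` CM
curves at `p ≥ 5`, LLP Conj. 4.11, and for O5a = twists of good supersingular curves, LLP Thm 4.5).
Before `n₀` the invariant saturates at `λ(θ_n) = 3^n − 1` or a layer has `μ(u_n) ≥ 1`.  EVIDENCE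
(λ of `u_n = θ_n/ω_{n−1}`, `1 ≤ n ≤ 5/6`, kit j121825 + j122348 + j122713; ALL 97 O5b-X4 rows of the
155-curve pilot × both branches = 194 row-branches; held-out = `N ≥ 10⁴` or a label-hash third, fixed
before the jobs ran): 194/194 fit the template selected by `s(W) = [v₃(j − 1728) ≥ 7]`, 167/194 from
`n₀ = 2` (train 59/64, held-out 108/130; the other 27 from `n₀ = 3`, 26 of them III* rows with
`μ(u₂) ≥ 1`), whereas under the SWAPPED assignment `s ↦ 1 − s` only 1/194 fits from `n₀ = 2` and 84/194
fit from no `n₀`; `0` rows mix the two templates; the parity of every residual constant is the one T5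
forces (III r0 generic `+`: `c = 1` 13/13, III r1 generic `+`: `c = 2` 4/4, III* r0 generic `+`:
`c ∈ {0, 2, 4, 6, 10}`, III CM-near `+`: `(c₀, c₁) ∈ {(1,1), (5,1), (3,1)}`, …; LAYER-LAWS.md §6,
`census/mt3_pilot/mt3_dichotomy.txt`).  HELD-OUT H2 (pre-registered, kit j124089, 100 unseen O5b-X4 rows, `n ≤ 5`):
discriminant `D_n = λ(u_{n+2}) − λ(u_n) − [III*]·8·3^{n−1} = 2·3^{n−1}·s(W)` on 331/335 clean pairs, 0 in the
other class, CM-near strata 149/149; the 4 disagreements are generic type-III r0 rows whose constant is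
reached at `n = 3` instead of `2` — inside the `∃ n₀` of the statement (generic III r0 `+` constants in H2:
`c ∈ {1 (9 rows), 3 (3), 5 (2)}`, which is what refuted T10).  Falsifier: one O5b-X4 row whose `λ(u_n)`, `2 ≤ n ≤ 5`, fits
neither template for its `s(W)` (instrument C-A2 at scale), in particular a generic row with
`λ(u_{n+1}) − λ(u_n) ∉ {0, 2·3^{n−1}}` for large `n` or a CM-near row with eventually constant `λ(u_n)`.
[cite: DoyonLei2021, §6] [cite: LeiPollackPratap2024, Thm 4.5, §4.3 and Conj. 4.11]
**RETIRED AS A NODE (append-only; declaration verbatim, `@[conjecture]` dropped — cc-typer-5 GEN 4 on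
o5-r1 GEN 3's consent, 2026-08-21T10:27Z): RE-KEYED BY `LocIrr W 3`.** The node of record is
`O5.GrowthDichotomyLawLocIrrThree` (`Additive/MazurTateGrowthDichotomyThree.lean`); on `j ≠ 1728` this
j-form is EQUIVALENT to it granted `Additive.SelectorIdentityTameThree` (bridges
`growthDichotomy_locIrr_of_growthDichotomyLaw` / `growthDichotomyLaw_conclusion_of_locIrr`, corollary
`growthDichotomyLawThree_of_ne_1728`), so every EVIDENCE line above transfers verbatim (the census never
met `j = 1728`); at `j = 1728` (`c₆ = 0`, CM by `ℤ[i]`, Kodaira III/III* at `3` when `v₃(c₄)` is odd) the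
selector `v₃(j − 1728)` is junk `0` and this form would put the curve on the UNSIGNED side, whereas
`LocIrr` holds there (`Additive.locIrr_three_of_c₆_eq_zero` granted L-O56-sel) and LLP Conj. 4.11 wants the
SIGNED pattern — the reason for the re-key. Not refuted by any census row; superseded, not withdrawn. -/
def GrowthDichotomyLawThree : Prop :=
  ∀ (W : WeierstrassCurve ℚ) [W.IsElliptic] [W.IsGloballyMinimal] [NeZero (W.conductorNorm ℤ)]
    (f : CuspForm (Gamma0 (W.conductorNorm ℤ)) 2), IsNewformOf W f → ClassO5 W 3 → SubTprime W 3 →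
    W.HasIrreducibleModPGaloisRep 3 → W.j ≠ 0 →
    ∃ n₀ c₀ c₁ : ℕ, (padicValRat 3 (W.j - 1728) < 7 → c₀ = c₁) ∧
      ∀ (n k : ℕ) (Θ : IwasawaAlgebra 3), n₀ ≤ n → IsScaledMazurTateLift f n k Θ → Θ ≠ 0 →
        lam Θ = (if padicValRat 3 W.Δ = 9 then 2 else 1) * 3 ^ (n - 1) +
          (if 7 ≤ padicValRat 3 (W.j - 1728) then kuriharaQ (n - 1) else 0) +
          (if n % 2 = 0 then c₀ else c₁)

/-! ### Withdrawn T10 (append-only tombstones; do not use)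

T10 `GenericTypeThreeRigidityLaw` ("generic type III, `ρ̄₃` irreducible, `r_an = 0`, no rank jump ⇒
`λ(θ_n) = 3^{n−1} + 1` for every `n ≥ 1`"; pilot 13/13) was REFUTED by o5-r1's PRE-REGISTERED held-out
run H2 (kit j124089, 283 unseen rows, frozen scorer b279fd417168d728; prereg
`HOME/b2b-bsdres-o5-r1/gen2/HELDOUT-PREREG.md`; `LAYER-LAWS.md` §4b 13cb8a520bd36dfd): 5 of the 14
qualifying held-out rows (15426d1, 16884e1, 12240ba1, 13860a1, 20286g1) have `λ(u_n⁺) ∈ {3, 5}` for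
`n ≥ 2` with `μ = 0`, no vanishing layer, `L(W,1)/Ω ∈ {2, 4}`. WITHDRAWN by its author (o5-r1 08:50Z);
what governs the residual constant is T11. Tree rule "deprecate, don't mutate": the two declarations of
p253649 are kept VERBATIM, the docstrings marked WITHDRAWN, the `@[conjecture]` tag DROPPED (a refuted
statement is not an obligation node of the cell) and the unreferenced corollary tagged `@[deprecated]`. -/

section WithdrawnT10

/-- WITHDRAWN — REFUTED on the pre-registered held-out run H2 (5/14: 15426d1, 16884e1, 12240ba1,
13860a1, 20286g1 have `λ(u_n⁺) ∈ {3,5}`, `n ≥ 2`; o5-r1 kit j124089). Former T10 "generic type-III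
rigidity": for `W ∈ O5b` of Kodaira type III at `3`, generic (`v₃(j − 1728) < 7`), `ρ̄_{W,3}`
irreducible, `r_an(W) = 0`, no layer of the cyclotomic tower with a rank jump (`θ_m ≠ 0`, `m ≥ 1`):
`λ(θ_n(W)) = 3^{n−1} + 1` for every `n ≥ 1`. FALSE as stated (negative knowledge: the residual constant
of T9 is NOT determined by `r_an`, jumps, `ord₃ L(W,1)/Ω`, torsion, Tamagawa numbers); kept verbatim as a
tombstone, no longer `@[conjecture]`; do not use. [cite: DoyonLei2021, Cor. 5.3 and §6] -/
def GenericTypeThreeRigidityLaw : Prop :=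
  ∀ (W : WeierstrassCurve ℚ) [W.IsElliptic] [W.IsGloballyMinimal] [NeZero (W.conductorNorm ℤ)]
    (f : CuspForm (Gamma0 (W.conductorNorm ℤ)) 2), IsNewformOf W f → ClassO5 W 3 → SubTprime W 3 →
    W.HasIrreducibleModPGaloisRep 3 → padicValRat 3 W.Δ = 3 → padicValRat 3 (W.j - 1728) < 7 →
    W.analyticRank = 0 → (∀ m : ℕ, 1 ≤ m → mazurTateElement f 3 m ≠ 0) →
    ∀ (n k : ℕ) (Θ : IwasawaAlgebra 3), 1 ≤ n → IsScaledMazurTateLift f n k Θ → Θ ≠ 0 →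
      lam Θ = 3 ^ (n - 1) + 1

/-- WITHDRAWN — bookkeeping corollary of the refuted T10 (`λ(θ₁) = 2` at layer one); vacuous record,
do not use. [folklore] -/
@[deprecated "withdrawn: T10 `GenericTypeThreeRigidityLaw` was refuted on o5-r1's held-out run H2 (2026-08-21); no replacement" (since := "2026-08-21")]
theorem lam_layerOne_eq_two_of_rigidity (h : GenericTypeThreeRigidityLaw)
    (W : WeierstrassCurve ℚ) [W.IsElliptic] [W.IsGloballyMinimal] [NeZero (W.conductorNorm ℤ)]
    (f : CuspForm (Gamma0 (W.conductorNorm ℤ)) 2) (k : ℕ) (Θ : IwasawaAlgebra 3)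
    (hf : IsNewformOf W f) (hO : ClassO5 W 3) (hT : SubTprime W 3)
    (hρ : W.HasIrreducibleModPGaloisRep 3) (hΔ : padicValRat 3 W.Δ = 3)
    (hj : padicValRat 3 (W.j - 1728) < 7) (hr : W.analyticRank = 0)
    (hz : ∀ m : ℕ, 1 ≤ m → mazurTateElement f 3 m ≠ 0)
    (hΘ : IsScaledMazurTateLift f 1 k Θ) (hΘ0 : Θ ≠ 0) : lam Θ = 2 := by
  have := h W f hf hO hT hρ hΔ hj hr hz 1 k Θ le_rfl hΘ hΘ0
  simpa using this

end WithdrawnT10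

/-! ## §3 T11 — the CONGRUENCE TRANSPORT law (Greenberg–Vatsal / Pollack–Weston shape at the additive prime 3) -/

/-- `3`-adic valuation of the `i`-th coefficient of `P ∈ ℚ[X]`, `⊤` for a zero coefficient
(junk-free: `padicValRat 3 0 = 0` is never used). [folklore] -/
def coeffValThree (P : ℚ[X]) (i : ℕ) : WithTop ℤ :=
  if P.coeff i = 0 then ⊤ else ((padicValRat 3 (P.coeff i) : ℤ) : WithTop ℤ)

/-- `μ` of a polynomial: the minimum coefficient valuation (`⊤` iff `P = 0`). [folklore] -/
def polyMuThree (P : ℚ[X]) : WithTop ℤ :=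
  (Finset.range (P.natDegree + 1)).inf (coeffValThree P)

/-- `λ` of a polynomial in the variable `X ↔ γ − 1`: the first index attaining the minimum valuation
(the `λ`-invariant of `P` read in `ℚ ⊗ ℤ₃⟦X⟧`; for `θ_n`, represented in degree `< 3^n`, this is the
layer `λ`-invariant of Pollack 2003 §6 used throughout). [cite: Pollack2003, §6.5] -/
def polyLamThree (P : ℚ[X]) : ℕ :=
  sInf {i : ℕ | coeffValThree P i = polyMuThree P}

/-- The exponent `s < 3^n` with `ℓ ≡ ± 4^s (mod 3^{n+1})`, i.e. `σ_ℓ|_{ℚ_n} = γ^s` for the tree's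
generator `γ = cyclotomicGenerator 3 = 4` (junk `0` when `3 ∣ ℓ`, never used). [folklore] -/
def layerIndexThree (n ℓ : ℕ) : ℕ :=
  sInf {s : ℕ | ((ℓ : ZMod (3 ^ (n + 1))) = (4 : ZMod (3 ^ (n + 1))) ^ s ∨
    (ℓ : ZMod (3 ^ (n + 1))) = -((4 : ZMod (3 ^ (n + 1))) ^ s))}

/-- The layer-`n` EULER FACTOR ELEMENT of `W` at a prime `ℓ ≠ 3` on branch `ε` (`true = +`, even
characters; `false = −`, the `χ₋₃`-twisted branch of `mazurTateElementOddThree`):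
`P^ε_{ℓ,n}(W) = 1 − χ_ε(ℓ) a_ℓ ℓ^{−1} (1+X)^s + 1_{ℓ ∤ N} ℓ^{−1} (1+X)^{2s mod 3^n}`, with `a_ℓ = W.LFunction ℓ`
and `1_{ℓ ∤ N}·ℓ = a_ℓ² − a_{ℓ²}` (so no reduction-type predicate is needed), represented in degree `< 3^n`.
[cite: GreenbergVatsal2000, §2 (Euler factor elements)] -/
def eulerElementThree (W : WeierstrassCurve ℚ) [W.IsElliptic] (ε : Bool) (ℓ n : ℕ) : ℚ[X] :=
  let s := layerIndexThree n ℓ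
  let a : ℚ := (W.LFunction ℓ : ℚ)
  let χ : ℚ := if ε then 1 else (jacobiSym (-3) ℓ : ℚ)
  1 - C (χ * a / ℓ) * (X + 1) ^ s
    + C (((W.LFunction ℓ : ℚ) ^ 2 - (W.LFunction (ℓ ^ 2) : ℚ)) / (ℓ : ℚ) ^ 2) * (X + 1) ^ (2 * s % 3 ^ n)

/-- The branch-`ε` layer element: `θ⁺_n = mazurTateElement f 3 n`, `θ⁻_n = mazurTateElementOddThree f n`.
[cite: Pollack2003, Def. 6.15] -/
def branchElementThree {N : ℕ} (f : CuspForm (Gamma0 N) 2) (ε : Bool) (n : ℕ) : ℚ[X] :=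
  haveI : Fact (Nat.Prime 3) := ⟨Nat.prime_three⟩
  if ε then mazurTateElement f 3 n else mazurTateElementOddThree f n

/-- **T11 CONGRUENCE TRANSPORT LAW (THEOREM-CANDIDATE; E3; EVIDENCE-labelled).**  For O5b curves
`W, W′` at `3` with the same Kodaira type (`v₃(Δ_min)` equal, i.e. both III or both III*), `ρ̄_{W,3}`
irreducible and `W[3]^{ss} ≅ W′[3]^{ss}` — typed as the congruence of Frobenius traces
`a_ℓ(W) ≡ a_ℓ(W′) (mod 3)` at every prime `ℓ ∤ 3 N N′` (equivalent by Brauer–Nesbitt–Chebotarev) — the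
difference of the layer `λ`-invariants on each branch is, for `n ≫ 0`, the difference of the Euler-factor
`λ`'s at the primes dividing `N N′` other than `3`:
`λ(θ^ε_n(W)) − λ(θ^ε_n(W′)) = Σ_{ℓ ∣ N N′, ℓ ≠ 3} (λ(P^ε_{ℓ,n}(W′)) − λ(P^ε_{ℓ,n}(W)))`.
Method that should prove it: Pollack–Weston's — the `Σ`-imprimitive layer element `θ^{Σ,ε}_n = θ^ε_n·∏_{ℓ∈Σ} P^ε_{ℓ,n}`
reduces mod `3` to a modular symbol mod `3` of level `Γ₀(∏_{ℓ ∈ Σ ∪ {3}} ℓ²…)` that depends only on `ρ̄`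
(Ihara / level raising for modular symbols), plus `μ(θ^ε_n) = 0` (empirically always at clean layers on
O5b-X4).  EVIDENCE (post-hoc on pilot + held-out H2, to be pre-registered on fresh conductors as C-A2c):
50/50 congruent same-type pairs on `+` and 50/50 on `−` at the top clean layer (`n = 4` or `5`), across
ranks and across the generic/CM-near divide of T9; 0 exceptions.  PRE-REGISTERED FRESH-UNIVERSE TEST C-A2c
(`HOME/…/census/c_a2c/`, cc-eng-3's ENG-D tower tables 8d041c675f5bd061, STEP-0 cross-engine 1 144/1 144): all 2 280
mod-3-congruent O5b pairs with both conductors in (26 000, 500 000) satisfy the identity on BOTH branches at the top layer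
and at EVERY clean layer `2 ≤ n ≤ 5` (12 221 (pair, branch, layer) identities, 0 violations; scorer 93de40778c907452 =
frozen 2b146c4f6a0d15da + a one-line input fix at `ℓ = 2` documented in `c_a2c/RESULT.md`); T9's selector is constant on
all 2 280 congruence classes met.  SAME LAW, found independently and typed first on the whole additive locus (`+` branch):
o6-r1 (G3-15) / `Additive.MazurTateLambdaCongruenceThree` (cc-typer-5 p256591) with local terms `m_ℓ·3^{min(n, v₃(ℓ²−1)−1)}`;
the present O5b statement differs only in (i) covering the odd branch `ε = −` (via `χ₋₃`), (ii) using the honest layer-`n`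
Euler `λ` (which is `m_ℓ·3^{v}·[v < n]`, `v = v₃(ℓ²−1) − 1`, and `2·3^{v}` at a double-eigenvalue prime — no unsaturation /
no-double-eigenvalue binders needed; the two conventions agree on every pair-layer met so far).  The typer decides whether
one node suffices.  Falsifier: one congruent same-type O5b pair violating the identity at all large `n`.
[cite: GreenbergVatsal2000, Thm 1.2 (shape)] [cite: PollackWeston2011MT, Thm. 1 (§1.1) and §4 (method)]
[cite: DoyonLei2021, Thm 2 (the conductor-27 instance at the additive prime 3)] -/
@[conjecture] def CongruenceTransportLawThree : Prop :=
  ∀ (W W' : WeierstrassCurve ℚ) [W.IsElliptic] [W.IsGloballyMinimal] [NeZero (W.conductorNorm ℤ)]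
    [W'.IsElliptic] [W'.IsGloballyMinimal] [NeZero (W'.conductorNorm ℤ)]
    (f : CuspForm (Gamma0 (W.conductorNorm ℤ)) 2) (f' : CuspForm (Gamma0 (W'.conductorNorm ℤ)) 2),
    IsNewformOf W f → IsNewformOf W' f' → ClassO5 W 3 → SubTprime W 3 → ClassO5 W' 3 → SubTprime W' 3 →
    W.HasIrreducibleModPGaloisRep 3 → padicValRat 3 W.Δ = padicValRat 3 W'.Δ →
    (∀ ℓ : ℕ, ℓ.Prime → ¬ (ℓ ∣ 3 * W.conductorNorm ℤ * W'.conductorNorm ℤ) →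
      ((W.LFunction ℓ : ℤ) : ZMod 3) = ((W'.LFunction ℓ : ℤ) : ZMod 3)) →
    ∃ n₀ : ℕ, ∀ (n : ℕ) (ε : Bool), n₀ ≤ n →
      (polyLamThree (branchElementThree f ε n) : ℤ) - polyLamThree (branchElementThree f' ε n) =
        ∑ ℓ ∈ ((W.conductorNorm ℤ * W'.conductorNorm ℤ).primeFactors.erase 3),
          ((polyLamThree (eulerElementThree W' ε ℓ n) : ℤ) - polyLamThree (eulerElementThree W ε ℓ n))

/-! ## §4 Kernel bookkeeping (nothing asserted) -/

/-- Sanity: at layer `0` the index of `ℓ = 1` is `0`. [folklore] -/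
theorem layerIndexThree_zero_one : layerIndexThree 0 1 = 0 := by
  unfold layerIndexThree
  apply le_antisymm (Nat.sInf_le (by simp)) (Nat.zero_le _)

end Summit.BirchSwinnertonDyer.Rank1Residual.O5

end
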